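import Summits.BirchSwinnertonDyer.BirchSwinnertonDyer.Theorems.ManinLocalTwoThreeNoAscendingTameThree
import Summits.BirchSwinnertonDyer.BirchSwinnertonDyer.Theorems.ManinLocalTwoThreeThreeBlindVeluAscent
import Summits.BirchSwinnertonDyer.BirchSwinnertonDyer.Theorems.ManinLocalTwoThreeCoprimeIsolatedResidualSplit
import Summits.BirchSwinnertonDyer.Rank1Residual.ManinAdditive.CuspidalKummerCubeNoBlindLaws
import Literature.NumberTheory.EllipticCurves.KatoAdditiveTwistedValueNeronIntegralityThree
import HarnessLib

/-!
# NB₃^V from the Kodaira POSITION LAW T3III on the tame band and its own wild restriction — the v15 split of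
# line `kato_shift_three`, as tree theorems

Summit `BirchSwinnertonDyer`, route `ManinLocalTwoThree` (cell bsd-f2-manin), deciding crux C3 `ManinPrimeToThreeAtNine`
(stmt-BirchSwinnertonDyer-22968), line `kato_shift_three`.  Skeleton v14 carried the stub NB₃^V
`CuspidalKummerThree.NoAscendingThreeTorsionOptimal` (no `X₀(N)`-optimal `W`, `9 ∣ N`, has a rational point of order `3` on
`E_{W,1}` whose Vélu `3`-quotient ASCENDS).  Seat p3 DISCHARGED that statement on the two tame potentially-good strata at
`3` WITHOUT optimality (`Theorems/ManinLocalTwoThreeNoAscendingTameThree.lean`, p649622: on `III` the `u = 1` Vélu pair is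
minimal, E-an-107; on `III*` there is no rational `3`-torsion point).  Skeleton v15 (lead p1 gen 7, registered on the crux
item) therefore SPLITS NB₃^V by stratum into

* T3III — an's row E-an-112 `OptimalRationalThreeTorsionIsTypeIII` (HOME/an/Sketch-an-g24.lean, MEMO-an §66.6; spelled out
  below as the hypothesis `h112`, VERBATIM): a lattice-optimal `W` with `9 ∣ N`, tame at `3` (`3² ∣ N(W)`, `3³ ∤ N(W)`) and a
  rational point of order `3` on `E_{W,1}` is of Kodaira type `III` (`ord₃ Δ_min(W) = 3`); census 3 286 / 3 286; OPEN;
* NB₃^V-wild — NB₃^V VERBATIM with `3³ ∣ N(W)` (hypothesis `hW` below); OPEN;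

and this file proves the recombination:

* `noAscendingThreeTorsion_tame_of_typeIIILaw` — on the tame band (conductor hypotheses on `W`, NO modularity) T3III alone
  gives NB₃^V's conclusion, through p3's `not_exists_three_velu_three_of_isShortThreeTorsion_of_III`;
* `noAscendingThreeTorsionOptimal_of_typeIIILaw_of_wild` — **NB₃^V ⟸ T3III ∧ NB₃^V-wild GIVEN modularity** (`exists_isNewformOf`
  turns the datum's level into the conductor, `IsNewformOf.level_eq_conductorNorm_of_exists_isNewformOf`, so `9 ∣ N` becomes
  `3² ∣ N(W)` and the tame / wild dichotomy is `3³ ∣ N(W)` or not);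
* `noBlindThreeTorsionOptimal_of_typeIIILaw_of_wild` — hence NB₃ (p645684);
* `maninPrimeToThreeAtNine_of_katoFact_of_cuspidalKummerCube_of_nonBlindLaw_of_typeIIILaw_of_wild_of_coprimeIsolated` — the
  v15 composition as ONE tree theorem: **C3 ⟸ F-es-18 ∧ E-an-57 ∧ LAW₃♮ ∧ T3III ∧ NB₃^V-wild ∧ RES₃♭** (modularity is the
  crux's own fourth binder).

HONEST FRAMING: implications between `c`-free statements; T3III and NB₃^V-wild are OPEN optimality laws (Stevens-II
strength: on `I₀*`/`Iₙ*` a rational `3`-torsion point always has `u = 3`, an's E-an-109, so T3III is exactly the tame content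
of NB₃^V); C3, Manin's conjecture and BSD are NOT proved.  No definitions, no named facts, no sorry.
References: [SilvermanATAEC1994] IV.9.4 Table 4.1; [DokchitserDokchitser2015LocalInvariants] Table 1; [DiamondShurman2005]
Thm. 5.8.2 (strong multiplicity one, level = conductor).
-/

set_option autoImplicit false
set_option linter.dupNamespace false

noncomputable section

open scoped Classical
open WeierstrassCurve Literature.NumberTheory.EllipticCurves Literature.NumberTheory.EllipticCurves.ModularForms
open Summit.BirchSwinnertonDyer.Rank1Residual.ManinAdditive
open Summit.BirchSwinnertonDyer.Rank1Residual.ManinAdditive.CuspidalKummer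
open Summit.BirchSwinnertonDyer.Rank1Residual.ManinAdditive.CuspidalKummerThree

namespace Summit.BirchSwinnertonDyer.BirchSwinnertonDyer.Theorems.ManinLocalTwoThree

/-- **NB₃^V on the TAME band from T3III alone (no modularity):** for a lattice-optimal `W` with `9 ∣ N`, `3² ∣ N(W)`,
`3³ ∤ N(W)`, granted the position law T3III (hypothesis `h112` = an's E-an-112 VERBATIM) no rational `3`-torsion point of
`E_{W,1}` ascends — T3III puts `W` on the `III` stratum and there the `u = 1` Vélu pair is minimal (p3, E-an-107).
[cite: SilvermanATAEC1994, IV.9.4 Table 4.1] [cite: DokchitserDokchitser2015LocalInvariants, Table 1] -/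
theorem noAscendingThreeTorsion_tame_of_typeIIILaw
    (h112 : ∀ (W : WeierstrassCurve ℚ) [W.IsElliptic] [W.IsGloballyMinimal] {N : ℕ} [NeZero N]
      (D : ModularParametrizationData W N),
      (∀ z ∈ D.L.lattice, ∃ w ∈ periodLattice D.f, z = D.c * w) → 9 ∣ N →
      3 ^ 2 ∣ W.conductorNorm ℤ → ¬ 3 ^ 3 ∣ W.conductorNorm ℤ →
        ∀ X₁ Y₁ : ℚ, IsShortThreeTorsion W 1 X₁ Y₁ → padicValInt 3 W.minimalDiscriminantInt = 3)
    (W : WeierstrassCurve ℚ) [W.IsElliptic] [W.IsGloballyMinimal] {N : ℕ} [NeZero N]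
    (D : ModularParametrizationData W N) (hL : ∀ z ∈ D.L.lattice, ∃ w ∈ periodLattice D.f, z = D.c * w) (h9 : 9 ∣ N)
    (h9' : 3 ^ 2 ∣ W.conductorNorm ℤ) (h27 : ¬ 3 ^ 3 ∣ W.conductorNorm ℤ) (X₁ Y₁ : ℚ)
    (hT : IsShortThreeTorsion W 1 X₁ Y₁) :
    ¬ ∃ W' : WeierstrassCurve ℚ, W'.IsElliptic ∧ W'.IsGloballyMinimal ∧
        (3 : ℚ) ^ 4 * W'.c₄ = 1440 * X₁ ^ 2 - 9 * W.c₄ ∧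
        (3 : ℚ) ^ 6 * W'.c₆ = 60480 * X₁ ^ 3 - 756 * W.c₄ * X₁ - 27 * W.c₆ :=
  not_exists_three_velu_three_of_isShortThreeTorsion_of_III W h9' h27 (h112 W D hL h9 h9' h27 X₁ Y₁ hT) hT

/-- **NB₃^V ⟸ T3III ∧ NB₃^V-wild, GIVEN modularity** (the v15 split of line `kato_shift_three` recombined): by strong
multiplicity one the datum's level is the conductor, so `9 ∣ N` reads `3² ∣ N(W)`; if `3³ ∣ N(W)` the wild restriction `hW`
(NB₃^V VERBATIM with that hypothesis) applies, otherwise `noAscendingThreeTorsion_tame_of_typeIIILaw`.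
[cite: DiamondShurman2005, Thm. 5.8.2] [cite: SilvermanATAEC1994, IV.9.4 Table 4.1] -/
theorem noAscendingThreeTorsionOptimal_of_typeIIILaw_of_wild (hnf : exists_isNewformOf)
    (h112 : ∀ (W : WeierstrassCurve ℚ) [W.IsElliptic] [W.IsGloballyMinimal] {N : ℕ} [NeZero N]
      (D : ModularParametrizationData W N),
      (∀ z ∈ D.L.lattice, ∃ w ∈ periodLattice D.f, z = D.c * w) → 9 ∣ N →
      3 ^ 2 ∣ W.conductorNorm ℤ → ¬ 3 ^ 3 ∣ W.conductorNorm ℤ →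
        ∀ X₁ Y₁ : ℚ, IsShortThreeTorsion W 1 X₁ Y₁ → padicValInt 3 W.minimalDiscriminantInt = 3)
    (hW : ∀ (W : WeierstrassCurve ℚ) [W.IsElliptic] [W.IsGloballyMinimal] {N : ℕ} [NeZero N]
      (D : ModularParametrizationData W N),
      (∀ z ∈ D.L.lattice, ∃ w ∈ periodLattice D.f, z = D.c * w) → 9 ∣ N → 3 ^ 3 ∣ W.conductorNorm ℤ →
      ∀ X₁ Y₁ : ℚ, IsShortThreeTorsion W 1 X₁ Y₁ →
      ¬ ∃ W' : WeierstrassCurve ℚ, W'.IsElliptic ∧ W'.IsGloballyMinimal ∧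
          (3 : ℚ) ^ 4 * W'.c₄ = 1440 * X₁ ^ 2 - 9 * W.c₄ ∧
          (3 : ℚ) ^ 6 * W'.c₆ = 60480 * X₁ ^ 3 - 756 * W.c₄ * X₁ - 27 * W.c₆) :
    NoAscendingThreeTorsionOptimal := by
  intro W _ _ N _ D hL h9 X₁ Y₁ hT
  have hN : N = W.conductorNorm ℤ := IsNewformOf.level_eq_conductorNorm_of_exists_isNewformOf hnf D.isNewformOf
  by_cases h27 : 3 ^ 3 ∣ W.conductorNorm ℤ
  · exact hW W D hL h9 h27 X₁ Y₁ hT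
  · have h9' : 3 ^ 2 ∣ W.conductorNorm ℤ := hN ▸ (by norm_num : (3 : ℕ) ^ 2 = 9) ▸ h9
    exact noAscendingThreeTorsion_tame_of_typeIIILaw h112 W D hL h9 h9' h27 X₁ Y₁ hT

/-- **NB₃ ⟸ T3III ∧ NB₃^V-wild, GIVEN modularity** (through NB₃ ⟸ NB₃^V, p645684).
[cite: DiamondShurman2005, Thm. 5.8.2] -/
theorem noBlindThreeTorsionOptimal_of_typeIIILaw_of_wild (hnf : exists_isNewformOf)
    (h112 : ∀ (W : WeierstrassCurve ℚ) [W.IsElliptic] [W.IsGloballyMinimal] {N : ℕ} [NeZero N]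
      (D : ModularParametrizationData W N),
      (∀ z ∈ D.L.lattice, ∃ w ∈ periodLattice D.f, z = D.c * w) → 9 ∣ N →
      3 ^ 2 ∣ W.conductorNorm ℤ → ¬ 3 ^ 3 ∣ W.conductorNorm ℤ →
        ∀ X₁ Y₁ : ℚ, IsShortThreeTorsion W 1 X₁ Y₁ → padicValInt 3 W.minimalDiscriminantInt = 3)
    (hW : ∀ (W : WeierstrassCurve ℚ) [W.IsElliptic] [W.IsGloballyMinimal] {N : ℕ} [NeZero N]
      (D : ModularParametrizationData W N),
      (∀ z ∈ D.L.lattice, ∃ w ∈ periodLattice D.f, z = D.c * w) → 9 ∣ N → 3 ^ 3 ∣ W.conductorNorm ℤ →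
      ∀ X₁ Y₁ : ℚ, IsShortThreeTorsion W 1 X₁ Y₁ →
      ¬ ∃ W' : WeierstrassCurve ℚ, W'.IsElliptic ∧ W'.IsGloballyMinimal ∧
          (3 : ℚ) ^ 4 * W'.c₄ = 1440 * X₁ ^ 2 - 9 * W.c₄ ∧
          (3 : ℚ) ^ 6 * W'.c₆ = 60480 * X₁ ^ 3 - 756 * W.c₄ * X₁ - 27 * W.c₆) :
    NoBlindThreeTorsionOptimal :=
  noBlindThreeTorsionOptimal_of_noAscendingThreeTorsionOptimal
    (noAscendingThreeTorsionOptimal_of_typeIIILaw_of_wild hnf h112 hW)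

/-- **The C3 line `kato_shift_three` v15 BY CONTENT, as ONE tree theorem: C3 `ManinPrimeToThreeAtNine` ⟸ F-es-18 ∧ E-an-57 ∧
LAW₃♮ ∧ T3III ∧ NB₃^V-wild ∧ RES₃♭** (modularity = the crux's own fourth binder feeds the recombined NB₃).  CONDITIONAL
reduction; nothing about BSD or Manin's conjecture is proved. [cite: Kato2004Asterisque, Thm. 6.6 (1) (shape of the input F-es-18 only)] -/
theorem maninPrimeToThreeAtNine_of_katoFact_of_cuspidalKummerCube_of_nonBlindLaw_of_typeIIILaw_of_wild_of_coprimeIsolated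
    (h₁ : kato_neron_isIntegral_twistedSymbolSum_of_additive_three_polar) (h₂ : CuspidalKummerCubeRepresentativeAtNine)
    (h₄ : CuspidalKummerCubeExponentLawNonBlind)
    (h112 : ∀ (W : WeierstrassCurve ℚ) [W.IsElliptic] [W.IsGloballyMinimal] {N : ℕ} [NeZero N]
      (D : ModularParametrizationData W N),
      (∀ z ∈ D.L.lattice, ∃ w ∈ periodLattice D.f, z = D.c * w) → 9 ∣ N →
      3 ^ 2 ∣ W.conductorNorm ℤ → ¬ 3 ^ 3 ∣ W.conductorNorm ℤ →
        ∀ X₁ Y₁ : ℚ, IsShortThreeTorsion W 1 X₁ Y₁ → padicValInt 3 W.minimalDiscriminantInt = 3)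
    (hW : ∀ (W : WeierstrassCurve ℚ) [W.IsElliptic] [W.IsGloballyMinimal] {N : ℕ} [NeZero N]
      (D : ModularParametrizationData W N),
      (∀ z ∈ D.L.lattice, ∃ w ∈ periodLattice D.f, z = D.c * w) → 9 ∣ N → 3 ^ 3 ∣ W.conductorNorm ℤ →
      ∀ X₁ Y₁ : ℚ, IsShortThreeTorsion W 1 X₁ Y₁ →
      ¬ ∃ W' : WeierstrassCurve ℚ, W'.IsElliptic ∧ W'.IsGloballyMinimal ∧
          (3 : ℚ) ^ 4 * W'.c₄ = 1440 * X₁ ^ 2 - 9 * W.c₄ ∧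
          (3 : ℚ) ^ 6 * W'.c₆ = 60480 * X₁ ^ 3 - 756 * W.c₄ * X₁ - 27 * W.c₆)
    (h₅ : NoRationalThreeTorsionCoprimeIsolatedResidual) :
    Summit.BirchSwinnertonDyer.BirchSwinnertonDyer.Theses.ManinLocalTwoThree.ManinPrimeToThreeAtNine := by
  intro hM hAU hC hnf
  exact maninPrimeToThreeAtNine_of_katoFact_of_cuspidalKummerCube_of_noBlindLaws_of_coprimeIsolated h₁ h₂ h₄
    (noBlindThreeTorsionOptimal_of_typeIIILaw_of_wild hnf h112 hW) h₅ hM hAU hC hnf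

end Summit.BirchSwinnertonDyer.BirchSwinnertonDyer.Theorems.ManinLocalTwoThree

end
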